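import Literature.NumberTheory.Sieve.ChenTwinSieveLowerHolds
import HarnessLib

/-!
# Chen's theorem, twin form: the sieve step of estimate (C) (Nathanson, Thm 10.6)

Topic `Literature/NumberTheory/Sieve`, family `parity` (parity.S12, `Literature.NumberTheory.Sieve.chen_twin`).
`Literature.NumberTheory.Sieve.ChenTwin` decomposes the twin form of Chen's theorem into three sieve
estimates; this file treats (C) `Literature.NumberTheory.Sieve.Chen.twin_sieveUpperB`, the twin-form
analogue of Nathanson, *Additive Number Theory: The Classical Bases* (GTM 164), Theorem 10.6:

  `S(B(x), y) ≤ (c e^γ/2 + ε) (x/log x) V(x^{1/8})`,  `B(x) = {p₁p₂p₃ − 2}`, `y = (x+3)^{1/3}`.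

Nathanson's proof (pp. 175–178 of the held copy) has three ingredients:

1. (**the sieve step**) enlarge `B` to the disjoint union `B̃ = ⋃_ℓ B^{(ℓ)}` over the grid
   `ℓ = z(1+ε)^k < y` (`B^{(ℓ)}`: `ℓ ≤ p₁ < (1+ε)ℓ`, `ℓ p₂p₃ < N`), apply the linear sieve upper bound
   (Thm 9.7 with `F(s) = 2e^γ/s`, Thm 9.8) at level `D ≈ N^{1/2}`, `s = log D/log y → 3/2`, and use
   `V(y)/V(z) → 3/8` (Mertens): `S(B, 𝒫, y) < (e^γ/2 + O(ε)) |B̃| V(z) + R`;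
2. (**the remainder**, (10.15) and §10.7) `R ≪ N/(log N)³` from the bilinear form inequality
   Thm 10.7 (large sieve + Siegel–Walfisz);
3. (**the cardinality**, p. 178) `|B̃| < (1 + O(ε)) c N/log N + O(N/(log N)²)` by the prime number
   theorem, `c = ∫_{1/8}^{1/3} log(2 − 3β)/(β(1 − β)) dβ`.

This file PROVES step 1 unconditionally, for the sequence `{p + 2}` (i.e. `N − p₁p₂p₃ ↦ p₁p₂p₃ − 2`),
with the linear sieve in the form PROVED in the tree — Iwaniec's Theorem 1 for `κ = 1`, uniform in
the sifted sequence (`Literature.NumberTheory.Sieve.Iwaniec1980_thm1_upper_of_half_lt`,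
`RosserSieveTheoremOneHalfLt.lean`), with `F₁(s) = 2e^γ/s` on `(0, 3]`
(`Literature.NumberTheory.Sieve.upperSieveFun_one_eq_holds`) — at level `D = x^{1/2 − δ}`:

* `Literature.NumberTheory.Sieve.Chen.roughCount_chenSetB_le` — for `0 < ε ≤ 1`, `0 < δ ≤ 1/8`, `θ > 0`
  and all large `x`,
  `S(B(x), y) ≤ (e^γ/(2(1 − 2δ)) + θ) · #T̃(x, ε) · V(x^{1/8}) + R(x, ε, x^{1/2−δ})`,
  where `T̃(x, ε)` (`chenTriplesExt`) is the set of triples `(p₁, p₂, p₃)` indexing `B̃` and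
  `R(x, ε, D) = ∑_{d < D, d ∣ P(y)} |#{t ∈ T̃ : d ∣ p₁p₂p₃ − 2} − g(d) #T̃|` (`chenRemainderExt`,
  `g = 1/φ` on odd `d`, `0` on even `d`);

and records the rest of the route as the conditional

* `Literature.NumberTheory.Sieve.Chen.twin_sieveUpperB_of` — steps 2 and 3, stated for `T̃(x, ε)` as
  explicit hypotheses (the cardinality bound `#T̃(x, ε) ≤ (1 + 2ε)(c + η) x/log x` and the remainder
  bound `R(x, ε, x^{1/2−δ}) ≤ C x/(log x)³`, eventually in `x`), imply `twin_sieveUpperB`.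

No new named facts are introduced (D-0026): the two hypotheses of `twin_sieveUpperB_of` are the
statements still to be proved (Nathanson (10.15)/Thm 10.7–10.8, and p. 178).

## The sieve step in detail

With `a(n) = #{t ∈ T̃ : p₁p₂p₃ − 2 = n}` (`chenSeqExt`, density `g = shiftedPrimesDensity 2`, size `#T̃`):
`S(B(x), y) ≤ #{t ∈ T̃ : (p₁p₂p₃ − 2, P(y)) = 1} = S(𝒜̃, P(y); 2x+4)` (`B ⊆ B̃` because `ℓ(p₁) ≤ p₁`;
`roughCount_chenSetB_le_card`, `sifted_chenSeqExt_eq`); Iwaniec's theorem gives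
`S ≤ #T̃ · V(y) · (F₁(s) + C (log D)^{−1/3}) + R` once `g` has dimension `Ω(1, L)`
(`hasIwaniecDimension_shiftedPrimesDensity_two` of `ChenTwinSieveLowerHolds.lean`, Mertens' product
theorem with rate); then
`F₁(s) = 2e^γ log y/log D`, `V(y) ≤ V(z) (log z/log y) e^{50/log z}` (`sieveProduct_two_le_mul`, Mertens,
`z = x^{1/8}`), so `V(y) F₁(s) ≤ e^{50/log z} V(z) · 2e^γ (1/8)/(1/2 − δ) = e^{50/log z} e^γ/(2(1−2δ)) V(z)`.

## References

* M. B. Nathanson, *Additive Number Theory: The Classical Bases*, GTM 164, Springer (1996), Thm 10.6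
  and its proof, pp. 175–178 of the held copy; (10.12)–(10.15). [Nathanson1996]
* H. Iwaniec, *Rosser's sieve*, Acta Arith. 36 (1980), 171–202, Theorem 1. [IwaniecActaArith1980]
* Chen Jing-run, Sci. Sinica 16 (1973), 157–176, p. 176 (the twin form "by the same method").
  [ChenSciSinica1973]
-/

open Finset Filter Topology

noncomputable section

namespace Literature.NumberTheory.Sieve.Chen

open ChenSieve SieveSequence

/-! ### The `(1+ε)`-adic grid (Nathanson (10.12)) -/

/-- The grid index of `p`: `k(p) = ⌊log(p/x^{1/8})/log(1+ε)⌋`, so that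
`ℓ = x^{1/8}(1+ε)^{k(p)} ≤ p < (1+ε)ℓ` (Nathanson (10.12): `ℓ = z(1+ε)^k`).
[cite: Nathanson1996, Thm 10.6 (proof, (10.12))] -/
def chenGridIndex (x : ℕ) (ε : ℝ) (p : ℕ) : ℕ :=
  ⌊Real.log ((p : ℝ) / (x : ℝ) ^ (1 / 8 : ℝ)) / Real.log (1 + ε)⌋₊

/-- The grid point `ℓ(p) = x^{1/8} (1+ε)^{k(p)}` below `p` (Nathanson (10.12)).
[cite: Nathanson1996, Thm 10.6 (proof, (10.12))] -/
def chenGridPoint (x : ℕ) (ε : ℝ) (p : ℕ) : ℝ :=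
  (x : ℝ) ^ (1 / 8 : ℝ) * (1 + ε) ^ chenGridIndex x ε p

/-- `ℓ(p) > 0` for `x ≥ 1`, `ε > 0`. [folklore] -/
theorem chenGridPoint_pos {x : ℕ} {ε : ℝ} (hx : 0 < x) (hε : 0 < ε) (p : ℕ) :
    0 < chenGridPoint x ε p := by
  unfold chenGridPoint
  have hx0 : (0 : ℝ) < x := by exact_mod_cast hx
  exact mul_pos (Real.rpow_pos_of_pos hx0 _) (pow_pos (by linarith) _)

/-- `ℓ(p) ≤ p` for `p ≥ x^{1/8}`. [cite: Nathanson1996, Thm 10.6 (proof, (10.12))] -/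
theorem chenGridPoint_le {x p : ℕ} {ε : ℝ} (hx : 0 < x) (hε : 0 < ε)
    (hp : (x : ℝ) ^ (1 / 8 : ℝ) ≤ p) : chenGridPoint x ε p ≤ p := by
  unfold chenGridPoint chenGridIndex
  have hx0 : (0 : ℝ) < x := by exact_mod_cast hx
  set z : ℝ := (x : ℝ) ^ (1 / 8 : ℝ) with hz
  have hz0 : 0 < z := Real.rpow_pos_of_pos hx0 _
  have hp0 : (0 : ℝ) < p := hz0.trans_le hp
  have hlog1 : 0 < Real.log (1 + ε) := Real.log_pos (by linarith)
  set q : ℝ := Real.log ((p : ℝ) / z) / Real.log (1 + ε) with hq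
  have hq0 : 0 ≤ q := div_nonneg (Real.log_nonneg (by rwa [le_div_iff₀ hz0, one_mul])) hlog1.le
  have hk : (⌊q⌋₊ : ℝ) ≤ q := Nat.floor_le hq0
  have hpow : (1 + ε) ^ ⌊q⌋₊ ≤ (p : ℝ) / z := by
    rw [← Real.rpow_natCast, Real.rpow_def_of_pos (by linarith)]
    calc Real.exp (Real.log (1 + ε) * (⌊q⌋₊ : ℝ)) ≤ Real.exp (Real.log (1 + ε) * q) :=
          Real.exp_le_exp.mpr (mul_le_mul_of_nonneg_left hk hlog1.le)
      _ = (p : ℝ) / z := by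
          rw [hq, mul_div_cancel₀ _ hlog1.ne', Real.exp_log (div_pos hp0 hz0)]
  calc z * (1 + ε) ^ ⌊q⌋₊ ≤ z * ((p : ℝ) / z) := mul_le_mul_of_nonneg_left hpow hz0.le
    _ = p := mul_div_cancel₀ _ hz0.ne'

/-- `p < (1+ε) ℓ(p)` for `p ≥ x^{1/8}`. [cite: Nathanson1996, Thm 10.6 (proof, (10.12))] -/
theorem lt_mul_chenGridPoint {x p : ℕ} {ε : ℝ} (hx : 0 < x) (hε : 0 < ε)
    (hp : (x : ℝ) ^ (1 / 8 : ℝ) ≤ p) : (p : ℝ) < (1 + ε) * chenGridPoint x ε p := by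
  unfold chenGridPoint chenGridIndex
  have hx0 : (0 : ℝ) < x := by exact_mod_cast hx
  set z : ℝ := (x : ℝ) ^ (1 / 8 : ℝ) with hz
  have hz0 : 0 < z := Real.rpow_pos_of_pos hx0 _
  have hp0 : (0 : ℝ) < p := hz0.trans_le hp
  have hlog1 : 0 < Real.log (1 + ε) := Real.log_pos (by linarith)
  set q : ℝ := Real.log ((p : ℝ) / z) / Real.log (1 + ε) with hq
  have hk : q < (⌊q⌋₊ : ℝ) + 1 := Nat.lt_floor_add_one q
  have hpow : (p : ℝ) / z < (1 + ε) ^ (⌊q⌋₊ + 1) := by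
    rw [← Real.rpow_natCast, Real.rpow_def_of_pos (by linarith)]
    calc (p : ℝ) / z = Real.exp (Real.log (1 + ε) * q) := by
          rw [hq, mul_div_cancel₀ _ hlog1.ne', Real.exp_log (div_pos hp0 hz0)]
      _ < Real.exp (Real.log (1 + ε) * ((⌊q⌋₊ + 1 : ℕ) : ℝ)) := by
          rw [Real.exp_lt_exp]
          push_cast
          exact mul_lt_mul_of_pos_left hk hlog1
  rw [div_lt_iff₀ hz0] at hpow
  calc (p : ℝ) < (1 + ε) ^ (⌊q⌋₊ + 1) * z := hpow
    _ = (1 + ε) * (z * (1 + ε) ^ ⌊q⌋₊) := by ring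

/-! ### The enlarged set of triples `T̃(x, ε)` and the sifted sequence it carries -/

/-- The enlarged index set `T̃(x, ε)` of Chen's switched set: triples of primes with
`x^{1/8} ≤ p₁ < y ≤ p₂ ≤ p₃`, `y = ⌈(x+3)^{1/3}⌉`, and `ℓ(p₁) p₂ p₃ ≤ x + 2` (Nathanson (10.13)–(10.14):
`B̃ = ⋃_ℓ B^{(ℓ)} ⊇ B`, the condition `p₁p₂p₃ < N` relaxed to `ℓ p₂p₃ < N` on the grid piece of `p₁`).
[cite: Nathanson1996, Thm 10.6 (proof, (10.13)–(10.14))] -/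
def chenTriplesExt (x : ℕ) (ε : ℝ) : Finset (ℕ × ℕ × ℕ) :=
  (Finset.range (2 * x + 5) ×ˢ Finset.range (2 * x + 5) ×ˢ Finset.range (2 * x + 5)).filter
    fun t : ℕ × ℕ × ℕ => t.1.Prime ∧ t.2.1.Prime ∧ t.2.2.Prime ∧ twinZ x ≤ t.1 ∧ t.1 < twinY x ∧
      twinY x ≤ t.2.1 ∧ t.2.1 ≤ t.2.2 ∧ chenGridPoint x ε t.1 * t.2.1 * t.2.2 ≤ (x : ℝ) + 2

/-- Membership in `T̃(x, ε)`. [folklore] -/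
theorem mem_chenTriplesExt {x : ℕ} {ε : ℝ} {t : ℕ × ℕ × ℕ} :
    t ∈ chenTriplesExt x ε ↔ (t.1 < 2 * x + 5 ∧ t.2.1 < 2 * x + 5 ∧ t.2.2 < 2 * x + 5) ∧
      t.1.Prime ∧ t.2.1.Prime ∧ t.2.2.Prime ∧ twinZ x ≤ t.1 ∧ t.1 < twinY x ∧
      twinY x ≤ t.2.1 ∧ t.2.1 ≤ t.2.2 ∧ chenGridPoint x ε t.1 * t.2.1 * t.2.2 ≤ (x : ℝ) + 2 := by
  simp only [chenTriplesExt, Finset.mem_filter, Finset.mem_product, Finset.mem_range]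

/-- For `t = (p₁, p₂, p₃) ∈ T̃(x, ε)` (`0 < ε ≤ 1`): `8 ≤ p₁p₂p₃` and `p₁p₂p₃ < 2x + 4`
(as `p₁ < (1+ε)ℓ(p₁) ≤ 2ℓ(p₁)` and `ℓ(p₁) p₂p₃ ≤ x + 2`). [folklore] -/
theorem prod_bounds_of_mem_chenTriplesExt {x : ℕ} {ε : ℝ} (hx : 0 < x) (hε : 0 < ε) (hε1 : ε ≤ 1)
    {t : ℕ × ℕ × ℕ} (ht : t ∈ chenTriplesExt x ε) :
    8 ≤ t.1 * t.2.1 * t.2.2 ∧ t.1 * t.2.1 * t.2.2 < 2 * x + 4 := by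
  obtain ⟨-, h₁, h₂, h₃, hz, -, -, -, hle⟩ := mem_chenTriplesExt.mp ht
  constructor
  · have a := h₁.two_le; have b := h₂.two_le; have c := h₃.two_le
    calc 8 = 2 * 2 * 2 := by norm_num
      _ ≤ t.1 * t.2.1 * t.2.2 := by gcongr
  · have hp : (x : ℝ) ^ (1 / 8 : ℝ) ≤ t.1 := twinZ_le_iff.mp hz
    have hlt := lt_mul_chenGridPoint hx hε hp
    have hℓ := chenGridPoint_pos hx hε t.1
    have h23 : (0 : ℝ) < (t.2.1 : ℝ) * t.2.2 := by
      have := h₂.pos; have := h₃.pos; positivity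
    have hreal : ((t.1 * t.2.1 * t.2.2 : ℕ) : ℝ) < 2 * x + 4 := by
      push_cast
      calc (t.1 : ℝ) * t.2.1 * t.2.2 = (t.1 : ℝ) * ((t.2.1 : ℝ) * t.2.2) := by ring
        _ < (1 + ε) * chenGridPoint x ε t.1 * ((t.2.1 : ℝ) * t.2.2) := by gcongr
        _ ≤ 2 * chenGridPoint x ε t.1 * ((t.2.1 : ℝ) * t.2.2) := by gcongr; linarith
        _ = 2 * (chenGridPoint x ε t.1 * t.2.1 * t.2.2) := by ring
        _ ≤ 2 * ((x : ℝ) + 2) := by gcongr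
        _ = 2 * x + 4 := by ring
    exact_mod_cast hreal

/-- The weights of the enlarged switched sequence: `a(n) = #{t ∈ T̃(x, ε) : p₁p₂p₃ − 2 = n}`
(the characteristic function `b̃(n)` of `B̃`, Nathanson p. 176, counted with the multiplicity of
its representations — which is in fact `≤ 1`). [cite: Nathanson1996, Thm 10.6 (proof)] -/
def chenWeightExt (x : ℕ) (ε : ℝ) (n : ℕ) : ℝ :=
  #((chenTriplesExt x ε).filter fun t : ℕ × ℕ × ℕ => t.1 * t.2.1 * t.2.2 - 2 = n)

/-- **The enlarged switched sequence** `𝒜̃` as a sifted sequence: weights `chenWeightExt`, density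
`g(d) = 1/φ(d)` on odd `d` and `0` on even `d` (`shiftedPrimesDensity 2`), size `#T̃(x, ε)`
(Nathanson p. 176: "`g(d) = 1/φ(d)`", `|B^{(ℓ)}_d| = |B^{(ℓ)}|/φ(d) + r_d^{(ℓ)}`).
[cite: Nathanson1996, Thm 10.6 (proof)] -/
def chenSeqExt (x : ℕ) (ε : ℝ) : SieveSequence where
  a := chenWeightExt x ε
  a_nonneg := fun _ => Nat.cast_nonneg _
  size := fun _ => #(chenTriplesExt x ε)
  density := shiftedPrimesDensity 2
  density_mult := isMultiplicative_shiftedPrimesDensity 2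

/-- The remainder of the enlarged switched sequence up to level `D`, sifting primes `< y`:
`R(x, ε, D) = ∑_{d < D, d ∣ P(y)} |#{t ∈ T̃ : d ∣ p₁p₂p₃ − 2} − g(d) · #T̃|`
(Nathanson's `∑_ℓ R^{(ℓ)}`, (10.15)). [cite: Nathanson1996, Thm 10.6 (proof, (10.15))] -/
def chenRemainderExt (x : ℕ) (ε D : ℝ) : ℝ :=
  ∑ d ∈ (Finset.range ⌈D⌉₊).filter (· ∣ primesProdBelow (twinY x : ℝ)),
    |(#((chenTriplesExt x ε).filter fun t : ℕ × ℕ × ℕ => d ∣ t.1 * t.2.1 * t.2.2 - 2) : ℝ) -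
      shiftedPrimesDensity 2 d * #(chenTriplesExt x ε)|

/-- `R(x, ε, D) ≥ 0`. [folklore] -/
theorem chenRemainderExt_nonneg (x : ℕ) (ε D : ℝ) : 0 ≤ chenRemainderExt x ε D :=
  Finset.sum_nonneg fun _ _ => abs_nonneg _

/-! ### Counting with the weights: fibres -/

/-- Summing fibre cardinalities: `∑_{n ∈ S} #{t ∈ T : g(t) = n} = #{t ∈ T : g(t) ∈ S}`. [folklore] -/
theorem sum_card_filter_eq_card_filter_mem {ι : Type*} (T : Finset ι) (g : ι → ℕ) (S : Finset ℕ) :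
    ∑ n ∈ S, (#(T.filter fun t => g t = n) : ℝ) = #(T.filter fun t => g t ∈ S) := by
  classical
  have hmaps : ((T.filter fun t => g t ∈ S : Finset ι) : Set ι).MapsTo g (S : Set ℕ) :=
    fun t ht => by
      have := (Finset.mem_filter.mp (Finset.mem_coe.mp ht)).2
      exact Finset.mem_coe.mpr this
  rw [Finset.card_eq_sum_card_fiberwise hmaps, Nat.cast_sum]
  refine Finset.sum_congr rfl fun n hn => ?_
  rw [Finset.filter_filter]
  congr 2
  ext t
  simp only [Finset.mem_filter]
  constructor
  · rintro ⟨ht, rfl⟩; exact ⟨ht, hn, rfl⟩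
  · rintro ⟨ht, -, h⟩; exact ⟨ht, h⟩

/-- `∑_{n ∈ S} a(n) = #{t ∈ T̃ : p₁p₂p₃ − 2 ∈ S}`. [folklore] -/
theorem sum_chenWeightExt_eq (x : ℕ) (ε : ℝ) (S : Finset ℕ) :
    ∑ n ∈ S, chenWeightExt x ε n =
      #((chenTriplesExt x ε).filter fun t : ℕ × ℕ × ℕ => t.1 * t.2.1 * t.2.2 - 2 ∈ S) := by
  unfold chenWeightExt
  exact sum_card_filter_eq_card_filter_mem _ _ _

/-- `S(𝒜̃, P; 2x+4) = #{t ∈ T̃ : (p₁p₂p₃ − 2, P) = 1}` (every `p₁p₂p₃ − 2` lies in `(0, 2x+4]`).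
[folklore] -/
theorem sifted_chenSeqExt_eq {x : ℕ} {ε : ℝ} (hx : 0 < x) (hε : 0 < ε) (hε1 : ε ≤ 1) (P : ℕ) :
    (chenSeqExt x ε).sifted ((2 * x + 4 : ℕ) : ℝ) P =
      #((chenTriplesExt x ε).filter fun t : ℕ × ℕ × ℕ => (t.1 * t.2.1 * t.2.2 - 2).Coprime P) := by
  change ∑ n ∈ (Finset.Ioc 0 ⌊((2 * x + 4 : ℕ) : ℝ)⌋₊).filter (fun n : ℕ => n.Coprime P),
    chenWeightExt x ε n = _
  rw [Nat.floor_natCast, sum_chenWeightExt_eq]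
  congr 2
  refine Finset.filter_congr fun t ht => ?_
  have hb := prod_bounds_of_mem_chenTriplesExt hx hε hε1 ht
  simp only [Finset.mem_filter, Finset.mem_Ioc]
  constructor
  · exact fun h => h.2
  · exact fun h => ⟨⟨by omega, by omega⟩, h⟩

/-- `|𝒜̃_d|(2x+4) = #{t ∈ T̃ : d ∣ p₁p₂p₃ − 2}`. [folklore] -/
theorem congrSum_chenSeqExt_eq {x : ℕ} {ε : ℝ} (hx : 0 < x) (hε : 0 < ε) (hε1 : ε ≤ 1) (d : ℕ) :
    (chenSeqExt x ε).congrSum d ((2 * x + 4 : ℕ) : ℝ) =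
      #((chenTriplesExt x ε).filter fun t : ℕ × ℕ × ℕ => d ∣ t.1 * t.2.1 * t.2.2 - 2) := by
  change ∑ n ∈ (Finset.Ioc 0 ⌊((2 * x + 4 : ℕ) : ℝ)⌋₊).filter (d ∣ ·), chenWeightExt x ε n = _
  rw [Nat.floor_natCast, sum_chenWeightExt_eq]
  congr 2
  refine Finset.filter_congr fun t ht => ?_
  have hb := prod_bounds_of_mem_chenTriplesExt hx hε hε1 ht
  simp only [Finset.mem_filter, Finset.mem_Ioc]
  constructor
  · exact fun h => h.2
  · exact fun h => ⟨⟨by omega, by omega⟩, h⟩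

/-- The remainder sum of Iwaniec's theorem for `𝒜̃` at height `2x+4` is `R(x, ε, D)`. [folklore] -/
theorem sum_abs_remainder_chenSeqExt_eq {x : ℕ} {ε : ℝ} (hx : 0 < x) (hε : 0 < ε) (hε1 : ε ≤ 1)
    (D : ℝ) :
    ∑ d ∈ (Finset.range ⌈D⌉₊).filter (· ∣ primesProdBelow (twinY x : ℝ)),
        |(chenSeqExt x ε).remainder d ((2 * x + 4 : ℕ) : ℝ)| = chenRemainderExt x ε D := by
  unfold chenRemainderExt
  refine Finset.sum_congr rfl fun d _ => ?_
  rw [SieveSequence.remainder, congrSum_chenSeqExt_eq hx hε hε1]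
  rfl

/-! ### From `B(x)` to `T̃(x, ε)` -/

/-- A `y`-rough positive integer is coprime to `P(y) = ∏_{p<y} p`. [folklore] -/
theorem coprime_primesProdBelow_of_isRough {y n : ℕ} (hn : n ≠ 0) (h : IsRough y n) :
    n.Coprime (primesProdBelow (y : ℝ)) := by
  rw [coprime_primesProdBelow_iff]
  intro q hq hdvd
  rw [Nat.ceil_natCast, Nat.mem_primesBelow] at hq
  have : y ≤ q := h q (Nat.mem_primeFactors.mpr ⟨hq.2, hdvd, hn⟩)
  omega

/-- **`B ⊆ B̃`, sifted** (Nathanson (10.14)): the number of `y`-rough elements of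
`B(x) = {p₁p₂p₃ − 2}` is at most the number of triples `t ∈ T̃(x, ε)` with `(p₁p₂p₃ − 2, P(y)) = 1`
(a triple of `B(x)` lies in `T̃` since `ℓ(p₁) ≤ p₁`). [cite: Nathanson1996, Thm 10.6 (proof, (10.14))] -/
theorem roughCount_chenSetB_le_card {x : ℕ} {ε : ℝ} (hx : 0 < x) (hε : 0 < ε) :
    roughCount (chenSetB x) (twinY x) ≤
      #((chenTriplesExt x ε).filter fun t : ℕ × ℕ × ℕ =>
        (t.1 * t.2.1 * t.2.2 - 2).Coprime (primesProdBelow (twinY x : ℝ))) := by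
  classical
  unfold roughCount
  refine le_trans (Finset.card_le_card (t := ((chenTriplesExt x ε).filter fun t : ℕ × ℕ × ℕ =>
      (t.1 * t.2.1 * t.2.2 - 2).Coprime (primesProdBelow (twinY x : ℝ))).image
    fun t : ℕ × ℕ × ℕ => t.1 * t.2.1 * t.2.2 - 2) ?_) Finset.card_image_le
  intro m hm
  rw [Finset.mem_filter] at hm
  obtain ⟨p₁, p₂, p₃, h₁, h₂, h₃, hz, hy, hy', h23, hle, rfl⟩ := mem_chenSetB.mp hm.1
  rw [Finset.mem_image]
  refine ⟨(p₁, p₂, p₃), ?_, rfl⟩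
  rw [Finset.mem_filter, mem_chenTriplesExt]
  have a := h₁.two_le; have b := h₂.two_le; have c := h₃.two_le
  have hp₁ : p₁ ≤ p₁ * p₂ * p₃ := by
    calc p₁ = p₁ * 1 * 1 := by ring
      _ ≤ p₁ * p₂ * p₃ := by gcongr <;> omega
  have hp₂ : p₂ ≤ p₁ * p₂ * p₃ := by
    calc p₂ = 1 * p₂ * 1 := by ring
      _ ≤ p₁ * p₂ * p₃ := by gcongr <;> omega
  have hp₃ : p₃ ≤ p₁ * p₂ * p₃ := by
    calc p₃ = 1 * 1 * p₃ := by ring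
      _ ≤ p₁ * p₂ * p₃ := by gcongr <;> omega
  have hgrid : chenGridPoint x ε p₁ * p₂ * p₃ ≤ (x : ℝ) + 2 := by
    have hℓ := chenGridPoint_le hx hε (twinZ_le_iff.mp hz)
    have hℓ0 := (chenGridPoint_pos hx hε p₁).le
    calc chenGridPoint x ε p₁ * p₂ * p₃ ≤ (p₁ : ℝ) * p₂ * p₃ := by gcongr
      _ = ((p₁ * p₂ * p₃ : ℕ) : ℝ) := by push_cast; ring
      _ ≤ ((x + 2 : ℕ) : ℝ) := by exact_mod_cast hle
      _ = (x : ℝ) + 2 := by push_cast; ring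
  refine ⟨⟨⟨?_, ?_, ?_⟩, h₁, h₂, h₃, hz, hy, hy', h23, hgrid⟩, ?_⟩
  · show p₁ < 2 * x + 5
    omega
  · show p₂ < 2 * x + 5
    omega
  · show p₃ < 2 * x + 5
    omega
  have h8 : 8 ≤ p₁ * p₂ * p₃ := by
    calc 8 = 2 * 2 * 2 := by norm_num
      _ ≤ p₁ * p₂ * p₃ := by gcongr
  have h8' : p₁ * p₂ * p₃ - 2 ≠ 0 := by omega
  exact coprime_primesProdBelow_of_isRough h8' hm.2

/-! ### The density `g = 1/φ` on odd moduli: `V(P(y)) = V(y)` -/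

/-- `V(P(y))` for the density `shiftedPrimesDensity 2` is `V(y) = ∏_{2<p<y} (1 − 1/(p−1))`
(`Literature.NumberTheory.Sieve.Chen.sieveProduct 2 y`; the prime `2` contributes the factor `1 − g(2) = 1`).
[cite: Nathanson1996, (10.8)] -/
theorem densityProduct_chenSeqExt_eq (x : ℕ) (ε : ℝ) (y : ℝ) :
    (chenSeqExt x ε).densityProduct (primesProdBelow y) = sieveProduct 2 y := by
  rw [SieveSequence.densityProduct, primeFactors_primesProdBelow, sieveProduct,
    ← Finset.prod_filter_mul_prod_filter_not (Nat.primesBelow ⌈y⌉₊) (fun p : ℕ => ¬p ∣ 2)]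
  have hone : ∏ p ∈ (Nat.primesBelow ⌈y⌉₊).filter (fun p : ℕ => ¬¬p ∣ 2),
      (1 - (chenSeqExt x ε).density p) = 1 := by
    refine Finset.prod_eq_one fun p hp => ?_
    rw [Finset.mem_filter, not_not, Nat.mem_primesBelow] at hp
    have hp2 : p = 2 := (Nat.prime_dvd_prime_iff_eq hp.1.2 Nat.prime_two).mp hp.2
    subst hp2
    change 1 - shiftedPrimesDensity 2 2 = 1
    rw [shiftedPrimesDensity_two_two, sub_zero]
  rw [hone, mul_one]
  refine Finset.prod_congr rfl fun p hp => ?_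
  rw [Finset.mem_filter, Nat.mem_primesBelow] at hp
  have hp2 : p ≠ 2 := fun h => hp.2 (h ▸ dvd_rfl)
  change 1 - shiftedPrimesDensity 2 p = _
  rw [shiftedPrimesDensity_two_prime hp.1.2 hp2]

/-! ### Mertens: `V(y) ≤ V(z) (log z/log y) e^{50/log z}` -/

/-- **The ratio `V(y)/V(z)`** (Nathanson p. 176: "`V(y)/V(z) = (log z/log y)(1 + O(1/log N))`", from
his Thm 10.3 / (10.3)); here the one-sided form that is needed, for `3 ≤ z ≤ y`:
`V(y) ≤ V(z) · (log z/log y) · e^{50/log z}`, since `∏_{z ≤ p < y} (1 − 1/(p−1)) ≤ ∏_{z ≤ p < y} (1 − 1/p)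
= Π(z)/Π(y)` and `|log Π(t) − log log t − γ| ≤ 25/log t` (Mertens with rate).
[cite: Nathanson1996, Thm 10.6 (proof) and Thm 6.8] -/
theorem sieveProduct_two_le_mul {z y : ℝ} (hz : 3 ≤ z) (hzy : z ≤ y) :
    sieveProduct 2 y ≤ sieveProduct 2 z * (Real.log z / Real.log y * Real.exp (50 / Real.log z)) := by
  have hlogz : 0 < Real.log z := Real.log_pos (by linarith)
  have hlogy : 0 < Real.log y := Real.log_pos (by linarith)
  set f : ℕ → ℝ := fun p => if ¬p ∣ 2 then 1 - 1 / ((p : ℝ) - 1) else 1 with hf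
  have hV : ∀ w : ℝ, sieveProduct 2 w = ∏ p ∈ Nat.primesBelow ⌈w⌉₊, f p := fun w => by
    rw [sieveProduct, hf, Finset.prod_filter]
  set S := (Nat.primesBelow ⌈y⌉₊).filter (fun p : ℕ => z ≤ (p : ℝ)) with hS
  have hmem : ∀ p ∈ S, p.Prime ∧ z ≤ (p : ℝ) := fun p hp => by
    rw [hS, Finset.mem_filter, Nat.mem_primesBelow] at hp
    exact ⟨hp.1.2, hp.2⟩
  have hsplit : sieveProduct 2 y = sieveProduct 2 z * ∏ p ∈ S, f p := by
    rw [hV y, hV z, hS, prod_primesBelow_split hzy]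
  -- the tail product is at most `Π(z)/Π(y)`
  have htail : ∏ p ∈ S, f p ≤ ∏ p ∈ S, (1 - (p : ℝ)⁻¹) := by
    refine Finset.prod_le_prod (fun p hp => ?_) fun p hp => ?_
    · have h3 : (3 : ℝ) ≤ p := hz.trans (hmem p hp).2
      rw [hf]; simp only
      split_ifs
      · norm_num
      · rw [sub_nonneg, div_le_one (by linarith)]; linarith
    · have h3 : (3 : ℝ) ≤ p := hz.trans (hmem p hp).2
      have hp2 : ¬p ∣ 2 := by
        intro h
        have := Nat.le_of_dvd two_pos h
        have : (p : ℝ) ≤ 2 := by exact_mod_cast this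
        linarith
      rw [hf]; simp only [hp2, not_false_eq_true, if_true]
      have h0 : (0 : ℝ) < p := by linarith
      rw [inv_eq_one_div, sub_le_sub_iff_left, div_le_div_iff₀ h0 (by linarith)]
      linarith
  have htail' : ∏ p ∈ S, (1 - (p : ℝ)⁻¹) = PairProducts.mertensProd z / PairProducts.mertensProd y := by
    have h := PairProducts.prod_filter_eq_mertensProd_div hzy
    rw [← hS] at h
    have h' : ∏ p ∈ S, (1 - (p : ℝ)⁻¹) = (∏ p ∈ S, (1 - (p : ℝ)⁻¹)⁻¹)⁻¹ := by
      rw [Finset.prod_inv_distrib, inv_inv]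
    rw [h', h, inv_div]
  have hmert : PairProducts.mertensProd z / PairProducts.mertensProd y ≤
      Real.log z / Real.log y * Real.exp (50 / Real.log z) := by
    set R := PairProducts.mertensProd z / PairProducts.mertensProd y with hR
    have hRpos : 0 < R := div_pos (PairProducts.mertensProd_pos z) (PairProducts.mertensProd_pos y)
    obtain ⟨-, hz2⟩ := abs_le.mp (PairProducts.abs_log_mertensProd_sub_le (show (2 : ℝ) ≤ z by linarith))
    obtain ⟨hy1, -⟩ := abs_le.mp (PairProducts.abs_log_mertensProd_sub_le (show (2 : ℝ) ≤ y by linarith))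
    have hlogR : Real.log R ≤ Real.log (Real.log z) - Real.log (Real.log y) + 50 / Real.log z := by
      rw [hR, Real.log_div (PairProducts.mertensProd_pos z).ne' (PairProducts.mertensProd_pos y).ne']
      have : 25 / Real.log y ≤ 25 / Real.log z :=
        div_le_div_of_nonneg_left (by norm_num) hlogz (Real.log_le_log (by linarith) hzy)
      have e50 : (50 : ℝ) / Real.log z = 2 * (25 / Real.log z) := by ring
      linarith
    calc R = Real.exp (Real.log R) := (Real.exp_log hRpos).symm
      _ ≤ Real.exp (Real.log (Real.log z) - Real.log (Real.log y) + 50 / Real.log z) :=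
          Real.exp_le_exp.mpr hlogR
      _ = Real.log z / Real.log y * Real.exp (50 / Real.log z) := by
          rw [Real.exp_add, Real.exp_sub, Real.exp_log hlogz, Real.exp_log hlogy]
  rw [hsplit]
  exact mul_le_mul_of_nonneg_left (htail.trans (htail' ▸ hmert)) (sieveProduct_two_mem_Icc z).1

/-! ### Eventual conditions in `x` -/

/-- `y(x) = ⌈(x+3)^{1/3}⌉ ≤ x^a` eventually, for every `a ≥ 3/8`. [folklore] -/
theorem eventually_twinY_le_rpow {a : ℝ} (ha : 3 / 8 ≤ a) :
    ∀ᶠ x : ℕ in atTop, (twinY x : ℝ) ≤ (x : ℝ) ^ a := by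
  filter_upwards [eventually_ge_atTop (3 ^ 24)] with x hx
  have hx1 : (1 : ℝ) ≤ x := by exact_mod_cast le_trans (Nat.one_le_pow _ _ (by norm_num)) hx
  have hx0 : (0 : ℝ) < x := by linarith
  -- `(x+3)^{1/3} ≤ 2 x^{1/3}`
  have h1 : ((x : ℝ) + 3) ^ (1 / 3 : ℝ) ≤ 2 * (x : ℝ) ^ (1 / 3 : ℝ) := by
    have h3 : ((x : ℝ) + 3) ≤ 8 * x := by linarith
    calc ((x : ℝ) + 3) ^ (1 / 3 : ℝ) ≤ (8 * x) ^ (1 / 3 : ℝ) :=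
          Real.rpow_le_rpow (by positivity) h3 (by norm_num)
      _ = 2 * (x : ℝ) ^ (1 / 3 : ℝ) := by
          rw [Real.mul_rpow (by norm_num) hx0.le,
            show (8 : ℝ) = (2 : ℝ) ^ (3 : ℕ) by norm_num, ← Real.rpow_natCast,
            ← Real.rpow_mul (by norm_num)]
          norm_num
  have h2 : (1 : ℝ) ≤ (x : ℝ) ^ (1 / 3 : ℝ) := Real.one_le_rpow hx1 (by norm_num)
  -- `3 ≤ x^{1/24}`
  have h3 : (3 : ℝ) ≤ (x : ℝ) ^ (1 / 24 : ℝ) := by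
    rw [show (3 : ℝ) = ((3 : ℝ) ^ (24 : ℕ)) ^ (1 / 24 : ℝ) by
      rw [← Real.rpow_natCast, ← Real.rpow_mul (by norm_num)]; norm_num]
    exact Real.rpow_le_rpow (by norm_num) (by exact_mod_cast hx) (by norm_num)
  have h4 : (x : ℝ) ^ (3 / 8 : ℝ) = (x : ℝ) ^ (1 / 3 : ℝ) * (x : ℝ) ^ (1 / 24 : ℝ) := by
    rw [← Real.rpow_add hx0]; norm_num
  have h5 : (x : ℝ) ^ (3 / 8 : ℝ) ≤ (x : ℝ) ^ a := Real.rpow_le_rpow_of_exponent_le hx1 ha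
  have hy : (twinY x : ℝ) < ((x : ℝ) + 3) ^ (1 / 3 : ℝ) + 1 := Nat.ceil_lt_add_one (by positivity)
  have h6 : ((x : ℝ) + 3) ^ (1 / 3 : ℝ) + 1 ≤ (x : ℝ) ^ (3 / 8 : ℝ) := by
    rw [h4]
    nlinarith
  linarith

/-- The sieve factor tends to its limit: for `K, C, a > 0... ` — precisely, for all real `K, C`,
`θ > 0`, `a > 0`, eventually in `x ∈ ℕ`,
`e^{400/log x} K + (3/8) e^{400/log x} C (a log x)^{−1/3} ≤ K + θ`. [folklore] -/
theorem eventually_sieveFactor_le (K C : ℝ) {θ a : ℝ} (hθ : 0 < θ) (ha : 0 < a) :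
    ∀ᶠ x : ℕ in atTop, Real.exp (400 / Real.log x) * K +
      3 / 8 * Real.exp (400 / Real.log x) * C * (a * Real.log x) ^ (-(1 / 3 : ℝ)) ≤ K + θ := by
  have h1 : Tendsto (fun X : ℝ => 400 / Real.log X) atTop (𝓝 0) :=
    tendsto_const_nhds.div_atTop Real.tendsto_log_atTop
  have h2 : Tendsto (fun X : ℝ => Real.exp (400 / Real.log X)) atTop (𝓝 1) := by
    have h := (Real.continuous_exp.tendsto 0).comp h1
    rw [Real.exp_zero] at h
    exact h
  have h3 : Tendsto (fun X : ℝ => (a * Real.log X) ^ (-(1 / 3 : ℝ))) atTop (𝓝 0) :=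
    (tendsto_rpow_neg_atTop (by norm_num : (0 : ℝ) < 1 / 3)).comp
      (Real.tendsto_log_atTop.const_mul_atTop ha)
  have h4 : Tendsto (fun X : ℝ => Real.exp (400 / Real.log X) * K +
      3 / 8 * Real.exp (400 / Real.log X) * C * (a * Real.log X) ^ (-(1 / 3 : ℝ))) atTop
      (𝓝 (1 * K + 3 / 8 * 1 * C * 0)) :=
    (h2.mul_const K).add (((h2.const_mul (3 / 8)).mul_const C).mul h3)
  simp only [one_mul, mul_one, mul_zero, add_zero] at h4
  have h5 := h4.comp tendsto_natCast_atTop_atTop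
  have h6 := h5.eventually_le_const (show K < K + θ by linarith)
  filter_upwards [h6] with x hx
  simpa using hx

/-! ### The sieve step -/

/-- `c ≥ 0`: the integrand `log(2 − 3β)/(β(1 − β))` of `switchingConstant` is nonnegative on
`[1/8, 1/3]`. [folklore] -/
theorem switchingConstant_nonneg : 0 ≤ switchingConstant := by
  rw [switchingConstant]
  refine intervalIntegral.integral_nonneg (by norm_num) fun β hβ => ?_
  have h1 : 0 ≤ Real.log (2 - 3 * β) := Real.log_nonneg (by linarith [hβ.2])
  have h2 : 0 < β * (1 - β) := by nlinarith [hβ.1, hβ.2]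
  exact div_nonneg h1 h2.le

/-- `c ≤ 2` (indeed `c < 2 log 3 − log 6 = log(3/2)`, `switchingIntegral_lt`). [folklore] -/
theorem switchingConstant_le_two : switchingConstant ≤ 2 := by
  have h := switchingIntegral_lt
  have h3 : Real.log 3 ≤ 3 - 1 := Real.log_le_sub_one_of_pos (by norm_num)
  have h2 : 0 ≤ Real.log 2 := Real.log_nonneg (by norm_num)
  have h6 : Real.log 6 = Real.log 2 + Real.log 3 := by
    rw [show (6 : ℝ) = 2 * 3 by norm_num, Real.log_mul (by norm_num) (by norm_num)]
  change (∫ β in (1 / 8 : ℝ)..(1 / 3), Real.log (2 - 3 * β) / (β * (1 - β))) ≤ 2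
  linarith

/-- The bookkeeping of the main term (pure algebra): if `V_y ≤ V_z ρ E`, `ρ F = K`, `ρ ≤ 3/8` and
`E K + (3/8) E C⁺ r ≤ K + θ`, then `T V_y (F + C r) ≤ T V_z (K + θ)` (all quantities `≥ 0`).
[folklore] -/
theorem sieve_mainTerm_algebra {T Vy Vz E ρ K θ C r F : ℝ} (hT : 0 ≤ T) (hVz : 0 ≤ Vz)
    (hVy : 0 ≤ Vy) (hE : 0 ≤ E) (hρ : ρ ≤ 3 / 8) (hr : 0 ≤ r) (hF : 0 ≤ F)
    (hVyle : Vy ≤ Vz * (ρ * E)) (hρF : ρ * F = K)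
    (hfac : E * K + 3 / 8 * E * max C 0 * r ≤ K + θ) :
    T * Vy * (F + C * r) ≤ T * Vz * (K + θ) := by
  have h1 : F + C * r ≤ F + max C 0 * r := by gcongr; exact le_max_left _ _
  have h1' : 0 ≤ F + max C 0 * r := by positivity
  have h2 : T * Vy * (F + C * r) ≤ T * Vy * (F + max C 0 * r) :=
    mul_le_mul_of_nonneg_left h1 (mul_nonneg hT hVy)
  have h3 : T * Vy * (F + max C 0 * r) ≤ T * (Vz * (ρ * E)) * (F + max C 0 * r) :=
    mul_le_mul_of_nonneg_right (mul_le_mul_of_nonneg_left hVyle hT) h1'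
  have h4 : T * (Vz * (ρ * E)) * (F + max C 0 * r) =
      T * Vz * (E * (ρ * F) + ρ * (E * (max C 0 * r))) := by ring
  have h5 : ρ * (E * (max C 0 * r)) ≤ 3 / 8 * (E * (max C 0 * r)) :=
    mul_le_mul_of_nonneg_right hρ (by positivity)
  have h6 : E * (ρ * F) + ρ * (E * (max C 0 * r)) ≤ K + θ := by
    rw [hρF]
    have : 3 / 8 * (E * (max C 0 * r)) = 3 / 8 * E * max C 0 * r := by ring
    linarith
  calc T * Vy * (F + C * r) ≤ T * Vy * (F + max C 0 * r) := h2
    _ ≤ T * (Vz * (ρ * E)) * (F + max C 0 * r) := h3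
    _ = T * Vz * (E * (ρ * F) + ρ * (E * (max C 0 * r))) := h4
    _ ≤ T * Vz * (K + θ) := mul_le_mul_of_nonneg_left h6 (mul_nonneg hT hVz)

set_option maxHeartbeats 400000 in
/-- **The sieve step of estimate (C)** (Nathanson, proof of Thm 10.6, pp. 175–176, for the sequence
`{p + 2}`): for `0 < ε ≤ 1`, `0 < δ ≤ 1/8`, `θ > 0` and all large `x`, with `y = ⌈(x+3)^{1/3}⌉`,
`z = x^{1/8}`, `V = sieveProduct 2`,

`S(B(x), y) ≤ (e^γ/(2(1 − 2δ)) + θ) · #T̃(x, ε) · V(z) + R(x, ε, x^{1/2−δ})`.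

Proof: `S(B(x), y) ≤ S(𝒜̃, P(y); 2x+4)` (`B ⊆ B̃`); Iwaniec's Theorem 1 (`κ = 1`, level
`D = x^{1/2−δ}`, PROVED in the tree) for `𝒜̃` with the density `1/φ` of dimension `Ω(1, L)` gives
`S ≤ #T̃ · V(y) (F₁(s) + C(log D)^{−1/3}) + R`, `s = log D/log y ∈ (0, 3/2]`, `F₁(s) = 2e^γ/s`; and
`V(y) F₁(s) ≤ e^{50/log z} V(z) (log z/log y)(2e^γ log y/log D) = e^{50/log z} e^γ/(2(1−2δ)) V(z)`,
`V(y) ≤ (3/8) e^{50/log z} V(z)`. (Nathanson: level `N^{1/2}(log N)^{−6}`, `s = 3/2 + o(1)`,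
`F(s) = 4e^γ/3 + o(1)`, `V(y)/V(z) = 3/8 + o(1)`, constant `e^γ/2 + O(ε)`.)
[cite: Nathanson1996, Thm 10.6 (proof, pp. 175–176)] -/
theorem roughCount_chenSetB_le {ε δ θ : ℝ} (hε : 0 < ε) (hε1 : ε ≤ 1) (hδ : 0 < δ) (hδ1 : δ ≤ 1 / 8)
    (hθ : 0 < θ) :
    ∀ᶠ x : ℕ in atTop,
      (roughCount (chenSetB x) (twinY x) : ℝ) ≤
        (Real.exp Real.eulerMascheroniConstant / (2 * (1 - 2 * δ)) + θ) *
            #(chenTriplesExt x ε) * sieveProduct 2 ((x : ℝ) ^ (1 / 8 : ℝ)) +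
          chenRemainderExt x ε ((x : ℝ) ^ (1 / 2 - δ)) := by
  -- Iwaniec's Theorem 1, `κ = 1`, for the dimension class of `g = 1/φ`
  obtain ⟨B, hB, hC⟩ := Iwaniec1980_thm1_upper_of_half_lt (κ := 1) (by norm_num)
  have hdim : HasIwaniecDimension (shiftedPrimesDensity 2) 1 (54 * Real.exp (54 / Real.log 2)) :=
    hasIwaniecDimension_shiftedPrimesDensity_two
  obtain ⟨CI, hCI⟩ := hC (54 * Real.exp (54 / Real.log 2))
  have hFeq : Set.EqOn B.1 (iwaniecUpperSieveFun 1) (Set.Ioi 0) := hB.eqOn_iwaniecSieveFun.1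
  set G := Real.exp Real.eulerMascheroniConstant with hG
  have hG0 : 0 < G := Real.exp_pos _
  set K := G / (2 * (1 - 2 * δ)) with hK
  have h12δ : 0 < 1 - 2 * δ := by linarith
  have hK0 : 0 ≤ K := by positivity
  have ha : 0 < 1 / 2 - δ := by linarith
  filter_upwards [eventually_ge_atTop 6561,
    eventually_twinY_le_rpow (show (3 : ℝ) / 8 ≤ 1 / 2 - δ by linarith),
    eventually_sieveFactor_le K (max CI 0) hθ ha] with x hx hYD hfac
  -- basic quantities
  have hxpos : 0 < x := by omega
  have hx1 : (1 : ℝ) < x := by exact_mod_cast (show 1 < x by omega)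
  have hx0 : (0 : ℝ) < x := by linarith
  have hlogx : 0 < Real.log x := Real.log_pos hx1
  have hL0 : Real.log (x : ℝ) ≠ 0 := hlogx.ne'
  set zr : ℝ := (x : ℝ) ^ (1 / 8 : ℝ) with hzr
  have hzr3 : 3 ≤ zr := by
    rw [hzr, show (3 : ℝ) = ((3 : ℝ) ^ (8 : ℕ)) ^ (1 / 8 : ℝ) by
      rw [← Real.rpow_natCast, ← Real.rpow_mul (by norm_num)]; norm_num]
    exact Real.rpow_le_rpow (by norm_num) (by exact_mod_cast hx) (by norm_num)
  have hlogzr : Real.log zr = 1 / 8 * Real.log x := Real.log_rpow hx0 _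
  set Y : ℝ := (twinY x : ℝ) with hY
  have hx13 : (x : ℝ) ^ (1 / 3 : ℝ) ≤ Y := by
    calc (x : ℝ) ^ (1 / 3 : ℝ) ≤ ((x : ℝ) + 3) ^ (1 / 3 : ℝ) :=
          Real.rpow_le_rpow hx0.le (by linarith) (by norm_num)
      _ ≤ Y := Nat.le_ceil _
  have hzY : zr ≤ Y :=
    le_trans (Real.rpow_le_rpow_of_exponent_le hx1.le (by norm_num)) hx13
  have hY2 : 2 ≤ Y := by linarith
  have hlogY : 1 / 3 * Real.log x ≤ Real.log Y := by
    have h := Real.log_le_log (Real.rpow_pos_of_pos hx0 _) hx13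
    rwa [Real.log_rpow hx0] at h
  have hlogY0 : 0 < Real.log Y := by linarith [mul_pos (by norm_num : (0 : ℝ) < 1 / 3) hlogx]
  have hLY0 : Real.log Y ≠ 0 := hlogY0.ne'
  set D : ℝ := (x : ℝ) ^ (1 / 2 - δ) with hD
  have hlogD : Real.log D = (1 / 2 - δ) * Real.log x := Real.log_rpow hx0 _
  have hlogD0 : 0 < Real.log D := by rw [hlogD]; positivity
  have hs0 : 0 < Real.log D / Real.log Y := div_pos hlogD0 hlogY0
  have hs3 : Real.log D / Real.log Y ≤ 3 := by
    rw [div_le_iff₀ hlogY0, hlogD]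
    nlinarith [mul_nonneg hδ.le hlogx.le]
  -- the sieve inequality for `𝒜̃`
  set A := chenSeqExt x ε with hA
  set H : ℝ := ((2 * x + 4 : ℕ) : ℝ) with hH
  have hsize : (0 : ℝ) ≤ A.size H := Nat.cast_nonneg _
  have hI := hCI A hdim H D Y hY2 hYD hsize
  -- identify the terms
  have hsift : (roughCount (chenSetB x) (twinY x) : ℝ) ≤ A.sifted H (primesProdBelow Y) := by
    rw [hA, hH, hY, sifted_chenSeqExt_eq hxpos hε hε1]
    exact_mod_cast roughCount_chenSetB_le_card hxpos hε
  have hsizeq : A.size H = #(chenTriplesExt x ε) := rfl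
  have hVq : A.densityProduct (primesProdBelow Y) = sieveProduct 2 Y :=
    densityProduct_chenSeqExt_eq x ε Y
  have hRq : ∑ d ∈ (Finset.range ⌈D⌉₊).filter (· ∣ primesProdBelow Y), |A.remainder d H| =
      chenRemainderExt x ε D := by
    rw [hA, hH, hY]
    exact sum_abs_remainder_chenSeqExt_eq hxpos hε hε1 D
  have hFs : B.1 (Real.log D / Real.log Y) = 2 * G / (Real.log D / Real.log Y) := by
    rw [hFeq hs0, ← upperSieveFun_one, upperSieveFun_one_eq_holds ⟨hs0, hs3⟩]
  rw [hsizeq, hVq, hRq, hFs, hlogD] at hI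
  -- the main term
  have hT0 : 0 ≤ (#(chenTriplesExt x ε) : ℝ) := Nat.cast_nonneg _
  have hVy0 : 0 ≤ sieveProduct 2 Y := (sieveProduct_two_mem_Icc Y).1
  have hVz0 : 0 ≤ sieveProduct 2 zr := (sieveProduct_two_mem_Icc zr).1
  have hE0 : 0 ≤ Real.exp (400 / Real.log x) := (Real.exp_pos _).le
  have hρle : 1 / 8 * Real.log x / Real.log Y ≤ 3 / 8 := by
    rw [div_le_iff₀ hlogY0]
    nlinarith
  have hr0 : 0 ≤ ((1 / 2 - δ) * Real.log x) ^ (-(1 / 3 : ℝ)) := Real.rpow_nonneg (by positivity) _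
  have hF0 : 0 ≤ 2 * G / ((1 / 2 - δ) * Real.log x / Real.log Y) := by positivity
  have hVyle : sieveProduct 2 Y ≤ sieveProduct 2 zr *
      (1 / 8 * Real.log x / Real.log Y * Real.exp (400 / Real.log x)) := by
    have h := sieveProduct_two_le_mul hzr3 hzY
    rw [hlogzr] at h
    have h50 : (50 : ℝ) / (1 / 8 * Real.log x) = 400 / Real.log x := by
      rw [div_mul_eq_div_div]
      norm_num
    rwa [h50] at h
  have hρF : 1 / 8 * Real.log x / Real.log Y * (2 * G / ((1 / 2 - δ) * Real.log x / Real.log Y)) = K := by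
    rw [hK]
    field_simp
    ring
  have hmain := sieve_mainTerm_algebra (C := CI) hT0 hVz0 hVy0 hE0 hρle hr0 hF0 hVyle hρF hfac
  -- conclude
  calc (roughCount (chenSetB x) (twinY x) : ℝ) ≤ A.sifted H (primesProdBelow Y) := hsift
    _ ≤ (#(chenTriplesExt x ε) : ℝ) * sieveProduct 2 Y *
          (2 * G / ((1 / 2 - δ) * Real.log x / Real.log Y) +
            CI * ((1 / 2 - δ) * Real.log x) ^ (-(1 / 3 : ℝ))) + chenRemainderExt x ε D := hI
    _ ≤ (#(chenTriplesExt x ε) : ℝ) * sieveProduct 2 zr * (K + θ) + chenRemainderExt x ε D := by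
        linarith
    _ = (K + θ) * #(chenTriplesExt x ε) * sieveProduct 2 zr + chenRemainderExt x ε D := by ring

/-! ### Estimate (C) from the cardinality and remainder bounds -/

/-- **Estimate (C) from steps 2 and 3 of Nathanson's proof.** If, for the enlarged triple set
`T̃(x, ε)` (`chenTriplesExt`),
(card) for all `0 < ε ≤ 1`, `η > 0` and large `x`, `#T̃(x, ε) ≤ (1 + 2ε)(c + η) x/log x`
  (Nathanson p. 178: `|B̃| < (1 + O(ε)) cN/log N + O(N/(log N)²)`, `c = switchingConstant`), and
(rem) for all `0 < ε ≤ 1`, `δ > 0` there is `C` with `R(x, ε, x^{1/2−δ}) ≤ C x/(log x)³` for large `x`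
  (Nathanson (10.15): `R^{(ℓ)} ≪ N/(log N)⁴` for each of the `O(ε⁻¹ log N)` pieces, from Thm 10.7),
then `twin_sieveUpperB` holds: given `ε₀ > 0` take `ε = δ = θ = t = min(1/8, ε₀/30)` in
`roughCount_chenSetB_le`; the main term is `≤ (e^γ/(2(1−2t)) + t)(1+2t)(c+t) X V ≤ (ce^γ/2 + 29t) X V`
(`c ≤ 2`, `e^γ ≤ 3`) and the remainder is `≤ t X V` as `X V ≥ 16e^{−7} x/(log x)²` (`twinMainTerm_ge`).
[cite: Nathanson1996, Thm 10.6 (proof, pp. 175–178)] -/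
theorem twin_sieveUpperB_of
    (hcard : ∀ ε : ℝ, 0 < ε → ε ≤ 1 → ∀ η : ℝ, 0 < η → ∀ᶠ x : ℕ in atTop,
      (#(chenTriplesExt x ε) : ℝ) ≤ (1 + 2 * ε) * (switchingConstant + η) * x / Real.log x)
    (hrem : ∀ ε : ℝ, 0 < ε → ε ≤ 1 → ∀ δ : ℝ, 0 < δ → ∃ C : ℝ, ∀ᶠ x : ℕ in atTop,
      chenRemainderExt x ε ((x : ℝ) ^ (1 / 2 - δ)) ≤ C * x / Real.log x ^ 3) :
    twin_sieveUpperB := by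
  intro ε₀ hε₀
  set G := Real.exp Real.eulerMascheroniConstant with hG
  set c := switchingConstant with hc
  have hc0 : 0 ≤ c := switchingConstant_nonneg
  have hc2 : c ≤ 2 := switchingConstant_le_two
  have hG0 : 0 < G := Real.exp_pos _
  have hG3 : G ≤ 3 := by
    have h1 : G ≤ Real.exp 1 :=
      Real.exp_le_exp.mpr (Real.eulerMascheroniConstant_lt_two_thirds.le.trans (by norm_num))
    have h2 := Real.exp_one_lt_d9
    linarith
  set t := min (1 / 8) (ε₀ / 30) with ht
  have ht0 : 0 < t := lt_min (by norm_num) (by positivity)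
  have ht8 : t ≤ 1 / 8 := min_le_left _ _
  have ht30 : 30 * t ≤ ε₀ := by
    have := min_le_right (1 / 8 : ℝ) (ε₀ / 30)
    rw [← ht] at this
    linarith
  have ht1 : t ≤ 1 := by linarith
  have hS := roughCount_chenSetB_le (ε := t) (δ := t) (θ := t) ht0 ht1 ht0 ht8 ht0
  have hT := hcard t ht0 ht1 t ht0
  obtain ⟨C, hR⟩ := hrem t ht0 ht1 t ht0
  have hjunk : ∀ᶠ x : ℕ in atTop, max C 0 * x / Real.log x ^ 3 ≤
      t * (16 * Real.exp (-7) * x / Real.log x ^ 2) := by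
    have hpos : 0 < t * (16 * Real.exp (-7)) := by positivity
    filter_upwards [(Real.tendsto_log_atTop.comp tendsto_natCast_atTop_atTop).eventually_ge_atTop
      (max C 0 / (t * (16 * Real.exp (-7)))), eventually_gt_atTop 1] with x hx hx1
    have hx1' : (1 : ℝ) < x := by exact_mod_cast hx1
    have hx0 : (0 : ℝ) < x := by linarith
    have hlog : 0 < Real.log x := Real.log_pos hx1'
    have hx' : max C 0 / (t * (16 * Real.exp (-7))) ≤ Real.log x := hx
    rw [div_le_iff₀ hpos] at hx'
    have hL : 0 < (x : ℝ) / Real.log x ^ 3 := by positivity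
    calc max C 0 * x / Real.log x ^ 3 = max C 0 * ((x : ℝ) / Real.log x ^ 3) := by ring
      _ ≤ Real.log x * (t * (16 * Real.exp (-7))) * ((x : ℝ) / Real.log x ^ 3) :=
          mul_le_mul_of_nonneg_right hx' hL.le
      _ = t * (16 * Real.exp (-7) * x / Real.log x ^ 2) := by
          field_simp
  filter_upwards [hS, hT, hR, hjunk, eventually_ge_atTop 6561] with x hSx hTx hRx hjx hx
  have hx1 : (1 : ℝ) < x := by exact_mod_cast (show 1 < x by omega)
  have hx0 : (0 : ℝ) < x := by linarith
  have hlog : 0 < Real.log x := Real.log_pos hx1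
  have hM := twinMainTerm_ge hx
  have hM0 := twinMainTerm_nonneg x
  have hV0 : 0 ≤ sieveProduct 2 ((x : ℝ) ^ (1 / 8 : ℝ)) := (sieveProduct_two_mem_Icc _).1
  set T : ℝ := (#(chenTriplesExt x t) : ℝ) with hTdef
  have hT0 : 0 ≤ T := Nat.cast_nonneg _
  -- `T V ≤ (1+2t)(c+t) X V`
  have h1 : T * sieveProduct 2 ((x : ℝ) ^ (1 / 8 : ℝ)) ≤ (1 + 2 * t) * (c + t) * twinMainTerm x := by
    rw [twinMainTerm]
    calc T * sieveProduct 2 ((x : ℝ) ^ (1 / 8 : ℝ))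
        ≤ ((1 + 2 * t) * (c + t) * x / Real.log x) * sieveProduct 2 ((x : ℝ) ^ (1 / 8 : ℝ)) :=
          mul_le_mul_of_nonneg_right hTx hV0
      _ = (1 + 2 * t) * (c + t) * ((x : ℝ) / Real.log x * sieveProduct 2 ((x : ℝ) ^ (1 / 8 : ℝ))) := by
          ring
  -- `R ≤ t X V`
  have h2 : chenRemainderExt x t ((x : ℝ) ^ (1 / 2 - t)) ≤ t * twinMainTerm x := by
    have hCle : C * x / Real.log x ^ 3 ≤ max C 0 * x / Real.log x ^ 3 := by
      have : 0 ≤ (x : ℝ) / Real.log x ^ 3 := by positivity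
      calc C * x / Real.log x ^ 3 = C * ((x : ℝ) / Real.log x ^ 3) := by ring
        _ ≤ max C 0 * ((x : ℝ) / Real.log x ^ 3) := mul_le_mul_of_nonneg_right (le_max_left _ _) this
        _ = max C 0 * x / Real.log x ^ 3 := by ring
    exact hRx.trans (hCle.trans (hjx.trans (mul_le_mul_of_nonneg_left hM ht0.le)))
  -- the constant
  have hKt : G / (2 * (1 - 2 * t)) ≤ G / 2 * (1 + 4 * t) := by
    rw [div_le_iff₀ (by linarith)]
    have h14 : (0 : ℝ) ≤ 1 - 4 * t := by linarith
    nlinarith [mul_nonneg (mul_nonneg hG0.le ht0.le) h14]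
  have hK0 : 0 ≤ G / (2 * (1 - 2 * t)) + t := by
    have : 0 < 2 * (1 - 2 * t) := by linarith
    positivity
  have hstep1 : (1 + 2 * t) * (c + t) ≤ c + 6 * t := by nlinarith
  have hstep2 : G / (2 * (1 - 2 * t)) + t ≤ G / 2 + 7 * t := by nlinarith
  have hstep3 : (G / 2 + 7 * t) * (c + 6 * t) ≤ c * G / 2 + 29 * t := by nlinarith
  have hΦ : (G / (2 * (1 - 2 * t)) + t) * ((1 + 2 * t) * (c + t)) + t ≤ c * G / 2 + ε₀ := by
    have hA : 0 ≤ (1 + 2 * t) * (c + t) := by positivity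
    have := mul_le_mul hstep2 hstep1 hA (by positivity)
    linarith
  calc (roughCount (chenSetB x) (twinY x) : ℝ)
      ≤ (G / (2 * (1 - 2 * t)) + t) * T * sieveProduct 2 ((x : ℝ) ^ (1 / 8 : ℝ)) +
          chenRemainderExt x t ((x : ℝ) ^ (1 / 2 - t)) := hSx
    _ ≤ (G / (2 * (1 - 2 * t)) + t) * ((1 + 2 * t) * (c + t) * twinMainTerm x) +
          t * twinMainTerm x := by
        have := mul_le_mul_of_nonneg_left h1 hK0
        nlinarith
    _ = ((G / (2 * (1 - 2 * t)) + t) * ((1 + 2 * t) * (c + t)) + t) * twinMainTerm x := by ring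
    _ ≤ (c * G / 2 + ε₀) * twinMainTerm x := mul_le_mul_of_nonneg_right hΦ hM0
    _ = (switchingConstant * Real.exp Real.eulerMascheroniConstant / 2 + ε₀) * twinMainTerm x := by
        rw [hc, hG]

end Literature.NumberTheory.Sieve.Chen
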